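import Summits.RiemannHypothesis.RiemannHypothesis.Theorems.WindowTraceArch.Negative.UnitMass
import Literature.NumberTheory.LFunctions.WeilDilationVirialDeriv
import HarnessLib

/-!
# The Christoffel squeeze across one collar (line `christoffel-margin`, first lemmas)

Route `RiemannHypothesis/SpectralTrace`, crux `WindowStep` (stmt-RiemannHypothesis-14659), line
`christoffel-margin` (idea card `Cruxes/WindowStep/Ideas/christoffel-margin.md`, ideator 5; skeleton
`Cruxes/WindowStep/Lines/christoffel_margin.lean`, crux-plan round 2). This file lands the line's
RH-FREE first lemmas (proved in the skeleton by the planner; recorded in `Theorems/` by the lead so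
that later seats can import them), in the tree's normalisation `Q(g) = W(g ⋆ g̃) = weilQuadratic g`,
`g_η = weilDilate η g` (Bombieri's dilation), `virial = weilDilationVirial`.

**What is proved (unconditional).** Let the real family `γ : ι → ℝ` reproduce the Weil functional on
the Weil tests supported in `[-A, A]`, let `η > 0` and let `h` be ANY Weil test supported in the
LARGER half window `[-(1+η)A/2, (1+η)A/2]`.
* `stub_christoffelSqueeze` / `squeeze_hasSum'` :
  `HasSum (i ↦ ‖(h_η)^(1/2+iγ_i)‖²) (Re Q(h) + ∫₀^η virial(h_s)/(1+s) ds)` — the dilate `h_η` is a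
  test of the half window `[-A/2, A/2]`, the family is a unit-weight sampling measure for it
  (`hasSum_norm_sq_of_windowTrace`) and `Re Q(h_η) = Re Q(h) + ∫₀^η virial`
  (`re_weilQuadratic_weilDilate_eq_add_integral`);
* `sum_norm_sq_le_virialBudget`, `negativity_squeezes_atoms'`, `norm_sq_lt_virialBudget_of_neg'` :
  every finite partial sum / single atom is bounded by `Re Q(h) + ∫₀^η virial`, hence by the virial
  budget alone when `Re Q(h) < 0` ("negativity one collar up starves every atom of every rung family");
* `nonneg_add_virialBudget_of_weilPositivityOn'` : what positivity alone gives one collar up —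
  `WeilPositivityOn (A/2) → 0 ≤ Re Q(h) + ∫₀^η virial` (no family needed);
* `weilMellin_weilDilate_atom'` : `(h_η)^(1/2+it) = (1+η)^{1/2}(1+η)⁻¹ ĥ(1/2 + it/(1+η))`.
-/

set_option linter.dupNamespace false

noncomputable section

open Complex Set MeasureTheory

namespace Summit.RiemannHypothesis.RiemannHypothesis.Theorems.SpectralTraceWindowStep

open Literature.NumberTheory.LFunctions
open Summit.RiemannHypothesis.RiemannHypothesis.Theorems.WindowTraceArch.Negative

/-- **stub_christoffelSqueeze — the squeeze, sum form (registered lead helper of line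
`christoffel-margin`).** For a real family `γ` reproducing `W` on the Weil tests of `[-A, A]`,
`η > 0` and a Weil test `h` of `[-(1+η)A/2, (1+η)A/2]`:
`HasSum (i ↦ ‖(h_η)^(1/2+iγ_i)‖²) (Re Q(h) + ∫₀^η virial(h_s)/(1+s) ds)`. [folklore] -/
theorem stub_christoffelSqueeze :
    ∀ (A η : ℝ) (ι : Type) (γ : ι → ℝ) (h : ℝ → ℂ),
      (∀ g : ℝ → ℂ, Literature.NumberTheory.LFunctions.IsWeilTest g → tsupport g ⊆ Set.Icc (-A) A →
        HasSum (fun i => Literature.NumberTheory.LFunctions.weilMellin g (1 / 2 + (γ i : ℂ) * Complex.I))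
          (Literature.NumberTheory.LFunctions.weilFunctional g)) →
      Literature.NumberTheory.LFunctions.IsWeilTest h → 0 < η →
      tsupport h ⊆ Set.Icc (-((1 + η) * (A / 2))) ((1 + η) * (A / 2)) →
        HasSum (fun i => ‖Literature.NumberTheory.LFunctions.weilMellin
            (Literature.NumberTheory.LFunctions.weilDilate η h) (1 / 2 + (γ i : ℂ) * Complex.I)‖ ^ 2)
          ((Literature.NumberTheory.LFunctions.weilQuadratic h).re +
            ∫ s in (0 : ℝ)..η, Literature.NumberTheory.LFunctions.weilDilationVirial
              (Literature.NumberTheory.LFunctions.weilDilate s h) / (1 + s)) := by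
  intro A η ι γ h hγ hh hη hsupp
  have hη' : -1 < η := by linarith
  have hne : (1 + η) ≠ 0 := by linarith
  have hs := tsupport_weilDilate_subset h hη' hsupp
  rw [mul_div_cancel_left₀ _ hne] at hs
  have hsum := hasSum_norm_sq_of_windowTrace hγ (hh.weilDilate hη') hs
  rwa [re_weilQuadratic_weilDilate_eq_add_integral hh hη'] at hsum

variable {A : ℝ} {ι : Type*} {γ : ι → ℝ}

/-- **The squeeze, sum form** (curried, any universe). [folklore] -/
theorem squeeze_hasSum'
    (hγ : ∀ g : ℝ → ℂ, IsWeilTest g → tsupport g ⊆ Icc (-A) A →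
      HasSum (fun i => weilMellin g (1 / 2 + (γ i : ℂ) * I)) (weilFunctional g))
    {h : ℝ → ℂ} (hh : IsWeilTest h) {η : ℝ} (hη : 0 < η)
    (hsupp : tsupport h ⊆ Icc (-((1 + η) * (A / 2))) ((1 + η) * (A / 2))) :
    HasSum (fun i => ‖weilMellin (weilDilate η h) (1 / 2 + (γ i : ℂ) * I)‖ ^ 2)
      ((weilQuadratic h).re +
        ∫ s in (0 : ℝ)..η, weilDilationVirial (weilDilate s h) / (1 + s)) := by
  have hη' : -1 < η := by linarith
  have hne : (1 + η) ≠ 0 := by linarith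
  have hs := tsupport_weilDilate_subset h hη' hsupp
  rw [mul_div_cancel_left₀ _ hne] at hs
  have hsum := hasSum_norm_sq_of_windowTrace hγ (hh.weilDilate hη') hs
  rwa [re_weilQuadratic_weilDilate_eq_add_integral hh hη'] at hsum

/-- Every FINITE partial sum of the squeezed atoms is bounded by `Re Q(h) + ∫₀^η virial`.
[folklore] -/
theorem sum_norm_sq_le_virialBudget
    (hγ : ∀ g : ℝ → ℂ, IsWeilTest g → tsupport g ⊆ Icc (-A) A →
      HasSum (fun i => weilMellin g (1 / 2 + (γ i : ℂ) * I)) (weilFunctional g))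
    {h : ℝ → ℂ} (hh : IsWeilTest h) {η : ℝ} (hη : 0 < η)
    (hsupp : tsupport h ⊆ Icc (-((1 + η) * (A / 2))) ((1 + η) * (A / 2))) (s : Finset ι) :
    ∑ i ∈ s, ‖weilMellin (weilDilate η h) (1 / 2 + (γ i : ℂ) * I)‖ ^ 2 ≤
      (weilQuadratic h).re +
        ∫ s in (0 : ℝ)..η, weilDilationVirial (weilDilate s h) / (1 + s) :=
  sum_le_hasSum s (fun _ _ => by positivity) (squeeze_hasSum' hγ hh hη hsupp)

/-- **Negativity one collar up squeezes every atom of every rung family** (one-term truncation):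
`‖(h_η)^(1/2+iγ_i)‖² ≤ Re Q(h) + ∫₀^η virial`. [folklore] -/
theorem negativity_squeezes_atoms'
    (hγ : ∀ g : ℝ → ℂ, IsWeilTest g → tsupport g ⊆ Icc (-A) A →
      HasSum (fun i => weilMellin g (1 / 2 + (γ i : ℂ) * I)) (weilFunctional g))
    {h : ℝ → ℂ} (hh : IsWeilTest h) {η : ℝ} (hη : 0 < η)
    (hsupp : tsupport h ⊆ Icc (-((1 + η) * (A / 2))) ((1 + η) * (A / 2))) (i : ι) :
    ‖weilMellin (weilDilate η h) (1 / 2 + (γ i : ℂ) * I)‖ ^ 2 ≤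
      (weilQuadratic h).re +
        ∫ s in (0 : ℝ)..η, weilDilationVirial (weilDilate s h) / (1 + s) :=
  le_hasSum (squeeze_hasSum' hγ hh hη hsupp) i fun _ _ => by positivity

/-- If `Re Q(h) < 0` one collar up, every atom's squared dilated transform is STRICTLY below the
virial budget `∫₀^η virial`. [folklore] -/
theorem norm_sq_lt_virialBudget_of_neg'
    (hγ : ∀ g : ℝ → ℂ, IsWeilTest g → tsupport g ⊆ Icc (-A) A →
      HasSum (fun i => weilMellin g (1 / 2 + (γ i : ℂ) * I)) (weilFunctional g))
    {h : ℝ → ℂ} (hh : IsWeilTest h) {η : ℝ} (hη : 0 < η)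
    (hsupp : tsupport h ⊆ Icc (-((1 + η) * (A / 2))) ((1 + η) * (A / 2)))
    (hneg : (weilQuadratic h).re < 0) (i : ι) :
    ‖weilMellin (weilDilate η h) (1 / 2 + (γ i : ℂ) * I)‖ ^ 2 <
      ∫ s in (0 : ℝ)..η, weilDilationVirial (weilDilate s h) / (1 + s) := by
  have h1 := negativity_squeezes_atoms' hγ hh hη hsupp i
  linarith

/-- And every finite partial sum is strictly below the budget when `Re Q(h) < 0`. [folklore] -/
theorem sum_norm_sq_lt_virialBudget_of_neg
    (hγ : ∀ g : ℝ → ℂ, IsWeilTest g → tsupport g ⊆ Icc (-A) A →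
      HasSum (fun i => weilMellin g (1 / 2 + (γ i : ℂ) * I)) (weilFunctional g))
    {h : ℝ → ℂ} (hh : IsWeilTest h) {η : ℝ} (hη : 0 < η)
    (hsupp : tsupport h ⊆ Icc (-((1 + η) * (A / 2))) ((1 + η) * (A / 2)))
    (hneg : (weilQuadratic h).re < 0) (s : Finset ι) :
    ∑ i ∈ s, ‖weilMellin (weilDilate η h) (1 / 2 + (γ i : ℂ) * I)‖ ^ 2 <
      ∫ s in (0 : ℝ)..η, weilDilationVirial (weilDilate s h) / (1 + s) := by
  have h1 := sum_norm_sq_le_virialBudget hγ hh hη hsupp s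
  linarith

/-- **What positivity ALONE gives one collar up** (no family): `WeilPositivityOn (A/2)` forces
`0 ≤ Re Q(h) + ∫₀^η virial` for every test `h` of the larger half window — so the surplus a unit
family adds is the DISTRIBUTION of the budget over atoms, not the sign of the budget. [folklore] -/
theorem nonneg_add_virialBudget_of_weilPositivityOn' (hpos : WeilPositivityOn (A / 2))
    {h : ℝ → ℂ} (hh : IsWeilTest h) {η : ℝ} (hη : 0 < η)
    (hsupp : tsupport h ⊆ Icc (-((1 + η) * (A / 2))) ((1 + η) * (A / 2))) :
    0 ≤ (weilQuadratic h).re +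
      ∫ s in (0 : ℝ)..η, weilDilationVirial (weilDilate s h) / (1 + s) := by
  have hη' : -1 < η := by linarith
  have hne : (1 + η) ≠ 0 := by linarith
  have hs := tsupport_weilDilate_subset h hη' hsupp
  rw [mul_div_cancel_left₀ _ hne] at hs
  rw [← re_weilQuadratic_weilDilate_eq_add_integral hh hη']
  exact hpos _ (hh.weilDilate hη') hs

/-- The transform of the dilate at height `t`, read at the CONTRACTED height `t/(1+η)`:
`(h_η)^(1/2+it) = (1+η)^{1/2}(1+η)⁻¹ ĥ(1/2 + it/(1+η))`. [folklore] -/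
theorem weilMellin_weilDilate_atom' (h : ℝ → ℂ) {η : ℝ} (hη : 0 < η) (t : ℝ) :
    weilMellin (weilDilate η h) (1 / 2 + (t : ℂ) * I) =
      (Real.sqrt (1 + η) : ℂ) * ((1 + η : ℝ) : ℂ)⁻¹ *
        weilMellin h (1 / 2 + ((t : ℂ) * I) / ((1 + η : ℝ) : ℂ)) := by
  rw [weilMellin_weilDilate h (by linarith : (-1 : ℝ) < η)]
  congr 2
  ring

end Summit.RiemannHypothesis.RiemannHypothesis.Theorems.SpectralTraceWindowStep

end
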